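import Mathlib
import HarnessLib
import Summits.SmoothPoincare4.Statement
import Summits.SmoothPoincare4.SmoothPoincare4.Theses.DissolvableGluck
import Summits.SmoothPoincare4.SmoothPoincare4.Theses.RootDecompT
import Literature.Topology.FourManifolds.Knots
import Literature.Topology.FourManifolds.Morse
import Literature.Topology.FourManifolds.GluckTwist
import Literature.Topology.FourManifolds.SurgeryGluck

/-!
# Line `two_minima` for the crux `GluckTwistsStandard` (stmt-SmoothPoincare4-17711) — skeleton

decomp-sp4 · lens 4 «minimal counterexample / extremal reduction» · gen 10 · species R (ORDER 2026-08-30T09:21:51Z).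

HOST CRUX (fixed, concluded BY NAME below):
`Summit.SmoothPoincare4.SmoothPoincare4.Theses.DissolvableGluck.GluckTwistsStandard` (pooled: `RootDecompT.GluckTwistsStandard`,
`RootDecompP`), «every Gluck twist `Σ_K` of `S⁴` along a 2-knot `K` is diffeomorphic to `S⁴`» — species R because
`Σ_K # ℂℙ² ≅ ℂℙ²` is a tree theorem (`gluckTwist_connectedSum_complexProjectivePlane_holds`), so this is the recognition
problem X₁ = `CP2CancellationOne` restricted to Gluck twists (`DissolvableGluck.gluck_of_cancel`).

THE LENS (extremal parameter of this generation) = the MORSE WIDTH of the 2-knot.  Let `h : S⁴ → ℝ` be the last coordinate.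
For a 2-knot `K : S² ↪ S⁴` whose height `h ∘ K` is Morse (generic: Guillemin–Pollack Ch. 1 §7 / Milnor, *Morse theory* Thm 6.6;
tree `MorseHeightFunctions.lean`), put `m(K) = #minima`, `M(K) = #maxima` (index-0 / index-2 critical points of `h ∘ K`) and
`w(K) = min(m, M)`.  Turning `S⁴` upside down swaps `m` and `M`, so `w` is the honest parameter.  STRATA:
* `w ≤ 1`  (one minimum or one maximum; v2 wording after critic OBJECTION HOME/STATUS.md l.905): by the Kawauchi–Shibuya–Suzuki
  normal form these are exactly the 2-knots `D ∪_U Δ` with `D` a ribbon disc (m minima, m − 1 fusion bands, NO maxima) of the UNKNOT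
  `U` and `Δ` the trivial cap — group ℤ, topologically unknotted (Freedman / Conway–Powell); `Σ_K = W_D ∪ B⁴` with
  `W_D := (B⁴ ∖ νD) ∪ h²(μ, product framing + 1)` a 3-handle-free homotopy ball.  DECIDED for m ≤ 2 (≤ four critical points:
  Scharlemann 1985, Invent. Math. 79); OPEN for m ≥ 3 (the «ribbon discs of the unknot are standard» circle).  NOT a floor in
  print and NOT «ribbon»: ribbon 2-knots with non-cyclic group (e.g. the spun trefoil, ⟨a,b ∣ aba = bab⟩) have width 2 in
  EVERY Morse position, since the rising-water decomposition S⁴∖νK = 0h ∪ m·1h ∪ s·2h ∪ M·3h ∪ 4h (GS §6.2) gives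
  rank π₁(S⁴ ∖ K) ≤ min(m, M) = width;
* `w = 2`  («2-knots with two minima», equivalently `K = D₁ ∪_k D̄₂` with `D₁` a fusion-number-one ribbon disc of the equator `k`,
  KSS rearrangement): the FIRST STRATUM CARRYING KNOTTED GROUPS — decided-TRUE rows: doubles `D ∪ D̄` of 1-fusion ribbon discs
  (ribbon 2-knots, Gluck 1962), twist-spun 2-bridge knots (Gordon 1976; GNS p13: the 2-twist-spun trefoil = two 6₁ discs),
  Nash–Stipsicz 2012 unions, twist-roll-spun knots of unknotting-number-one knots (Naylor–Schwartz 2020); Gabai–Naylor–Schwartz 2025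
  Thm 1.1 / Thm 5.5 / Cor 5.1 give, for a hemisphere of undisking number one, that the DOUBLE `Σ_{S # −S}` is standard and `Σ_S` is a
  SCHOENFLIES BALL (embeds in S⁴) — NOT that `Σ_K ≅ S⁴`; the stratum CONTAINS GNS Question 5.4 (which asks for the Thm-1.1 analogue on
  fusion-number-one hemispheres) and is strictly bigger (it asks Σ_K ≅ S⁴); it is the stratum the cell can INSTRUMENT (banded-unlink
  diagrams with two minima ⟶ Kirby diagram of `Σ_K` by GNS Def. 3.1 ⟶ standardisation search; T-2MIN v2 protocol in two_minima.md §6);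
* `w ≥ 3`: the declared residual of the line.
Minimal-counterexample normal form (kernel file `../MorseWidthLadder.lean`, 0 sorry): if the crux fails then, by genericity,
there is a least width `w₀` carrying a non-standard Gluck twist, every narrower height-Morse 2-knot has standard Gluck twists, and —
GIVEN the hypothesis `WidthLeOneStandard` (decided for ≤ 2 minima only) — `w₀ ≥ 2`; unconditionally the ladder has TWO open strata
beneath the residual: w ≤ 1 with ≥ 3 minima (group ℤ, 3-handle-free, A16-adjacent) and w = 2.

Shape (W1 form by the writer decomp-sp4-writer-1 g4 of the lens-4 g10 file, statements unchanged; v2 = docstrings only, lens-4 g11):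
four registered stubs `stub_heightGeneric` (STRUCTURE) · `stub_widthLeOne` (WEAKER · UNDECIDED for ≥ 3 minima, decided ≤ 2) · `stub_twoMinima`
(LOAD-BEARING, open, attacked, instrumentable) · `stub_widthGeThree` (RESIDUAL), and the composition `GluckTwistsStandard_of`
concluding the host crux by name with a REAL proof (genericity, then a three-way case split on `w`).  Sorries live only in `stub_*`.
-/

set_option linter.dupNamespace false

namespace Summit.SmoothPoincare4.SmoothPoincare4.Cruxes.GluckTwistsStandard.TwoMinima

open scoped Manifold ContDiff
open Literature.Topology.FourManifolds

/-! ## 1. The extremal parameter: Morse width of a 2-knot -/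

/-- The height `h(p) = p₄` (last coordinate) on `S⁴ ⊂ ℝ⁵`. -/
noncomputable def heightFour (p : Metric.sphere (0 : EuclideanSpace ℝ (Fin 5)) 1) : ℝ :=
  (p : EuclideanSpace ℝ (Fin 5)) 4

/-- The height function of the 2-knot `K : S² ↪ S⁴`, `h ∘ K : S² → ℝ`. -/
noncomputable def knotHeight (K : TwoKnot) : Metric.sphere (0 : EuclideanSpace ℝ (Fin 3)) 1 → ℝ :=
  heightFour ∘ ⇑K

/-- `K` is in MORSE POSITION w.r.t. the height: `h ∘ K` is a Morse function on `S²`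
(tree `Literature.Topology.FourManifolds.IsMorse`: smooth, every critical point nondegenerate). -/
def IsHeightMorse (K : TwoKnot) : Prop :=
  IsMorse (𝓡 2) (knotHeight K)

/-- Number of minima (index-0 critical points) of the height of `K` (`Set.ncard`; finite for a Morse function on compact `S²`). -/
noncomputable def minimaCount (K : TwoKnot) : ℕ :=
  (criticalSetOfIndex (𝓡 2) (knotHeight K) 0).ncard

/-- Number of maxima (index-2 critical points) of the height of `K`. -/
noncomputable def maximaCount (K : TwoKnot) : ℕ :=
  (criticalSetOfIndex (𝓡 2) (knotHeight K) 2).ncard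

/-- The MORSE WIDTH of the position: `w(K) = min(#minima, #maxima)`. -/
noncomputable def width (K : TwoKnot) : ℕ :=
  min (minimaCount K) (maximaCount K)

/-- «Gluck twists along `K` are standard»: the host crux with the knot fixed (same binders, verbatim). -/
def GluckStandardAlong (K : TwoKnot) : Prop :=
  ∀ (X : Type) [TopologicalSpace X] [T2Space X] [SecondCountableTopology X]
    [ChartedSpace (EuclideanSpace ℝ (Fin 4)) X] [IsManifold (𝓡 4) ∞ X],
    IsGluckTwist (𝓡 4) X K → Nonempty (X ≃ₘ⟮𝓡 4, 𝓡 4⟯ Metric.sphere (0 : EuclideanSpace ℝ (Fin 5)) 1)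

/-- The host crux is `∀ K, GluckStandardAlong K`, definitionally. -/
theorem gluckTwistsStandard_iff_forall :
    Theses.DissolvableGluck.GluckTwistsStandard ↔ ∀ K : TwoKnot, GluckStandardAlong K :=
  Iff.rfl

/-- The pooled copies of the crux agree verbatim (route `RootDecompT` r4 = route `DissolvableGluck` r4). -/
example : Theses.RootDecompT.GluckTwistsStandard ↔ Theses.DissolvableGluck.GluckTwistsStandard := Iff.rfl

/-- … and both are the body of the registered open conjecture `GluckTwistConjecture.{0}`. -/
example : GluckTwistConjecture.{0} ↔ Theses.DissolvableGluck.GluckTwistsStandard := Iff.rfl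

/-! ## 2. The pieces (statements of the stubs) -/

/-- STRUCTURE piece: every Gluck twist is a Gluck twist along a 2-knot in Morse position (rotate `K` by a generic
`A ∈ SO(5)`: `h ∘ A ∘ K` is Morse for a.e. `A` — Guillemin–Pollack Ch. 1 §7, tree `MorseHeightFunctions.lean` — and
`Σ_{A∘K} ≅ Σ_K`, indeed `IsGluckTwist X (A ∘ K)` with `ν' = A ∘ ν`). -/
def HeightGeneric : Prop :=
  ∀ (K : TwoKnot) (X : Type) [TopologicalSpace X] [T2Space X] [SecondCountableTopology X]
    [ChartedSpace (EuclideanSpace ℝ (Fin 4)) X] [IsManifold (𝓡 4) ∞ X],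
    IsGluckTwist (𝓡 4) X K → ∃ K' : TwoKnot, IsHeightMorse K' ∧ IsGluckTwist (𝓡 4) X K'

/-- ONE-EXTREMUM piece (`w ≤ 1`; v2 tag WEAKER · UNDECIDED): a 2-knot with a Morse position having a single minimum or a single
maximum is `D ∪_U Δ`, a ribbon disc `D` of the UNKNOT capped trivially (KSS); its Gluck twist `W_D ∪ B⁴` is standard for ≤ 2 minima
(Scharlemann 1985, four critical points) and OPEN for ≥ 3 minima; the piece asserts standardness for all of them. -/
def WidthLeOneStandard : Prop :=
  ∀ K : TwoKnot, IsHeightMorse K → width K ≤ 1 → GluckStandardAlong K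

/-- LOAD-BEARING piece (`w = 2`, OPEN): Gluck twists of 2-knots admitting a Morse position with width exactly two (two minima or,
upside down, two maxima, the other count being ≥ 2) are standard.  ⊇ GNS 2025 Question 5.4 (strictly: Q5.4 asks double-standard /
Schoenflies for fusion-one hemispheres, this asks Σ_K ≅ S⁴); decided-TRUE rows: Glu62 ribbon doubles, Gordon 1976, Nash–Stipsicz 2012,
Naylor–Schwartz 2020; GNS Thm 1.1 / 5.5 give double standard / Schoenflies ball only. -/
def TwoMinimaStandard : Prop :=
  ∀ K : TwoKnot, IsHeightMorse K → width K = 2 → GluckStandardAlong K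

/-- RESIDUAL piece (`w ≥ 3`): the declared remainder of the line. -/
def WidthGeThreeStandard : Prop :=
  ∀ K : TwoKnot, IsHeightMorse K → 3 ≤ width K → GluckStandardAlong K

/-! ## 3. Registered stubs -/

/-- STRUCTURE · size M · genericity of Morse height functions + ambient isometry invariance of `IsGluckTwist`. -/
theorem stub_heightGeneric : HeightGeneric := by
  sorry

/-- ONE-EXTREMUM stratum · WEAKER · UNDECIDED (decided ≤ 2 minima, Scharlemann 1985; open ≥ 3 minima) · ATTACKABLE · INSTRUMENTABLE. -/
theorem stub_widthLeOne : WidthLeOneStandard := by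
  sorry

/-- LOAD-BEARING · OPEN · the width-two stratum (⊇ GNS 2025 Q5.4). -/
theorem stub_twoMinima : TwoMinimaStandard := by
  sorry

/-- RESIDUAL · declared · width ≥ 3. -/
theorem stub_widthGeThree : WidthGeThreeStandard := by
  sorry

/-! ## 4. Composition — REAL proof, concludes the host crux BY NAME -/

/-- Hypothesis form of the composition (sorry-free): genericity, then the three width strata exhaust `ℕ`.
(W1 form, writer decomp-sp4-writer-1 g4: the conclusion is spelled `∀ K, GluckStandardAlong K` — definitionally the host
crux, `gluckTwistsStandard_iff_forall` — so that `GluckTwistsStandard_of` below stays the ONLY theorem concluding the crux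
decl BY NAME, as in the registered `Lines/birth.lean` of this crux; a binder-form theorem ending in the decl name is read
by the skeleton audit as a conditional proof of the item.) -/
theorem gluckTwistsStandard_of_pieces (hG : HeightGeneric) (h₁ : WidthLeOneStandard) (h₂ : TwoMinimaStandard)
    (h₃ : WidthGeThreeStandard) : ∀ K : TwoKnot, GluckStandardAlong K := by
  intro K X _ _ _ _ _ hX
  obtain ⟨K', hK', hX'⟩ := hG K X hX
  rcases Nat.lt_or_ge (width K') 2 with hw | hw
  · exact h₁ K' hK' (by omega) X hX'
  · rcases Nat.lt_or_ge (width K') 3 with hw' | hw'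
    · exact h₂ K' hK' (by omega) X hX'
    · exact h₃ K' hK' hw' X hX'

/-- **W1 form.** The line concludes the crux `DissolvableGluck.GluckTwistsStandard` (stmt-SmoothPoincare4-17711) by name;
`sorry` is reachable only through the four `stub_*`. -/
theorem GluckTwistsStandard_of : Theses.DissolvableGluck.GluckTwistsStandard :=
  gluckTwistsStandard_of_pieces stub_heightGeneric stub_widthLeOne stub_twoMinima stub_widthGeThree

/-- The pooled copy on `RootDecompT` (same item stmt-SmoothPoincare4-17711, verbatim twin) is concluded by the same term —
an `example`, not a theorem, so that the skeleton audit sees exactly one by-name proof of the item (writer W1 form; use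
`ledger skeleton check … --crux-decl Summit.SmoothPoincare4.SmoothPoincare4.Theses.DissolvableGluck.GluckTwistsStandard`
if the default decl of the pooled item is another twin). -/
example : Theses.RootDecompT.GluckTwistsStandard :=
  GluckTwistsStandard_of

-- The composition itself uses no `sorry` (only the stubs do): `#print axioms` prints no `sorryAx` warning-free info only.
#guard_msgs (drop info) in #print axioms gluckTwistsStandard_of_pieces

end Summit.SmoothPoincare4.SmoothPoincare4.Cruxes.GluckTwistsStandard.TwoMinima
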